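import Mathlib

/-!
# Uniform convexity of the hard-sphere mathematical entropy — the Hessian budget

Helper file for the route support item `CollisionIsometryCLT.HsEntropyUniformlyConvex`
(stmt-AtomisticToContinuum-9525). The pointwise coercivity estimate for the second derivative,
along a straight line `t ↦ (ρ₀ + ta, m₀ + t • b, E₀ + tc)` in conserved variables, of the
ideal-gas part of the mathematical entropy
`(3/2)(ρ log ρ - ρ log w) + μρ² - m(ρ² + ‖m‖² + E²)`, `w = E - ‖m‖²/(2ρ)` (internal energy
density), at a point of the kinetic chamber `{c₁/2 < ρ, ‖m‖² < 2ρE, E < E₁}`.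

With `q = ‖m‖²`, `q₁ = 2⟪m, b⟫`, `q₂ = 2‖b‖²` (the squared momentum along the line and its two
derivatives), `w₁ = c - q₁/(2ρ) + aq/(2ρ²)`, `w₂ = -q₂/(2ρ) + aq₁/ρ² - a²q/ρ³` (the derivatives of
`w`), the second derivative is `(3/2)(ρ(a/ρ - w₁/w)² - ρw₂/w) + 2μa² - m(2a² + q₂ + 2c²)`, and the
two Hessian terms are the squares `(ρ/w²)(s - ⟪u, d⟫)²` and `‖d‖²/w` with `u = m/ρ`,
`d = b - a u`, `s = c - aE/ρ`; on the chamber `w < E₁`, `ρ/w² > c₁/(2E₁²)`, `‖u‖² < 4E₁/c₁`,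
`(E/ρ)² < 4E₁²/c₁²`, whence nonnegativity once `32 m E₁² ≤ 3c₁`, `4 m E₁ (2 + 16E₁/c₁) ≤ 3`
and `m (1 + 8E₁/c₁ + 8E₁²/c₁²) ≤ μ`.

* `idealEntropy_hessian_budget_real` — the estimate with all vector data replaced by real
  numbers (`D = ‖d‖²`, `P = ⟪u, d⟫`) and the two facts `‖b‖² ≤ 2‖d‖² + 2a²‖u‖²`,
  `P² ≤ ‖u‖² D` taken as hypotheses;
* `idealEntropy_hessian_budget` — the estimate itself, in a real inner product space.

Elementary. [folklore]
-/

noncomputable section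

namespace Summit.AtomisticToContinuum.HydrodynamicLimit.Theorems

open Set

open scoped RealInnerProductSpace

/-- `(x + y)² ≤ 2x² + 2y²`. [folklore] -/
theorem add_sq_le_two_mul_sq (x y : ℝ) : (x + y) ^ 2 ≤ 2 * x ^ 2 + 2 * y ^ 2 := by
  nlinarith [sq_nonneg (x - y)]

/-- **The Hessian budget, scalar form.** See the module docstring; `q, q₁, q₂` are the squared
momentum and its two derivatives along the line, `D = ‖d‖² = q₂/2 - a q₁/ρ + a² q/ρ²`,
`P = ⟪u, d⟫ = q₁/(2ρ) - a q/ρ²`, and `hB`, `hCS` are the parallelogram and Cauchy–Schwarz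
inequalities `q₂/2 ≤ 2D + 2a² q/ρ²`, `P² ≤ (q/ρ²) D`. [folklore] -/
theorem idealEntropy_hessian_budget_real {c₁ E₁ μ m ρ E a c q q₁ q₂ D P : ℝ}
    (hc₁ : 0 < c₁) (hE₁ : 0 < E₁) (hm : 0 ≤ m) (hm₁ : m * (32 * E₁ ^ 2) ≤ 3 * c₁)
    (hm₂ : m * (4 * E₁ * (2 + 16 * E₁ / c₁)) ≤ 3)
    (hm₃ : m * (1 + 8 * E₁ / c₁ + 8 * E₁ ^ 2 / c₁ ^ 2) ≤ μ)
    (hρ : c₁ / 2 < ρ) (hq0 : 0 ≤ q) (hq : q < 2 * ρ * E) (hE : E < E₁)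
    (hD : D = q₂ / 2 - a * q₁ / ρ + a ^ 2 * q / ρ ^ 2) (hD0 : 0 ≤ D)
    (hP : P = q₁ / (2 * ρ) - a * q / ρ ^ 2)
    (hB : q₂ / 2 ≤ 2 * D + 2 * (a ^ 2 * (q / ρ ^ 2))) (hCS : P ^ 2 ≤ q / ρ ^ 2 * D) :
    0 ≤ 3 / 2 * (ρ * (a / ρ - (c - q₁ / (2 * ρ) + a * q / (2 * ρ ^ 2)) / (E - q / (2 * ρ))) ^ 2
        - ρ * (-q₂ / (2 * ρ) + a * q₁ / ρ ^ 2 - a ^ 2 * q / ρ ^ 3) / (E - q / (2 * ρ)))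
      + 2 * μ * a ^ 2 - m * (2 * a ^ 2 + q₂ + 2 * c ^ 2) := by
  have hρ0 : 0 < ρ := by linarith only [hρ, hc₁]
  have hρne : ρ ≠ 0 := hρ0.ne'
  obtain ⟨w, hw_def⟩ : ∃ w, w = E - q / (2 * ρ) := ⟨_, rfl⟩
  rw [← hw_def]
  have hqρ : q / (2 * ρ) < E := by
    rw [div_lt_iff₀ (by positivity)]
    linarith only [hq]
  have hqρ0 : 0 ≤ q / (2 * ρ) := by positivity
  have hw0 : 0 < w := by rw [hw_def]; linarith only [hqρ]
  have hwne : w ≠ 0 := hw0.ne'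
  have hwE : w ≤ E := by rw [hw_def]; linarith only [hqρ0]
  have hwE₁ : w < E₁ := hwE.trans_lt hE
  have hE0 : 0 < E := by linarith only [hqρ, hqρ0]
  -- bounds on `‖u‖² = q/ρ²` and `e = E/ρ`
  have hu_bd : q / ρ ^ 2 ≤ 4 * E₁ / c₁ := by
    rw [div_le_div_iff₀ (by positivity) hc₁]
    have h1 : q * c₁ ≤ (2 * ρ * E) * c₁ := mul_le_mul_of_nonneg_right hq.le hc₁.le
    have h2 : (2 * ρ * E) * c₁ ≤ (2 * ρ * E) * (2 * ρ) :=
      mul_le_mul_of_nonneg_left (by linarith only [hρ]) (by positivity)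
    have h3 : (2 * ρ) * E ≤ (2 * ρ) * E₁ := mul_le_mul_of_nonneg_left hE.le (by positivity)
    have h4 : (2 * ρ * E) * (2 * ρ) ≤ (2 * ρ * E₁) * (2 * ρ) :=
      mul_le_mul_of_nonneg_right h3 (by positivity)
    linarith only [h1, h2, h4]
  have he_bd : (E / ρ) ^ 2 ≤ 4 * E₁ ^ 2 / c₁ ^ 2 := by
    rw [div_pow, div_le_div_iff₀ (by positivity) (by positivity)]
    have h1 : E * c₁ ≤ E₁ * (2 * ρ) := mul_le_mul hE.le (by linarith only [hρ]) hc₁.le hE₁.le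
    have h0 : 0 ≤ E * c₁ := by positivity
    have h2 := mul_le_mul h1 h1 h0 (by positivity)
    linarith only [h2]
  -- the identities `-ρ w₂ = D` and `w₁ - a w/ρ = s - P`
  have hI2 : -q₂ / (2 * ρ) + a * q₁ / ρ ^ 2 - a ^ 2 * q / ρ ^ 3 = -D / ρ := by
    rw [hD]
    field_simp
    ring
  obtain ⟨s, hs_def⟩ : ∃ s, s = c - a * E / ρ := ⟨_, rfl⟩
  have hI1 : (c - q₁ / (2 * ρ) + a * q / (2 * ρ ^ 2)) - a * w / ρ = s - P := by
    rw [hP, hs_def, hw_def]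
    field_simp
    ring
  obtain ⟨X, hX_def⟩ : ∃ X, X = s - P := ⟨_, rfl⟩
  have hT1 : ρ * (a / ρ - (c - q₁ / (2 * ρ) + a * q / (2 * ρ ^ 2)) / w) ^ 2
      = ρ / w ^ 2 * X ^ 2 := by
    have : a / ρ - (c - q₁ / (2 * ρ) + a * q / (2 * ρ ^ 2)) / w
        = -(((c - q₁ / (2 * ρ) + a * q / (2 * ρ ^ 2)) - a * w / ρ) / w) := by
      field_simp
      ring
    rw [this, hI1, ← hX_def, neg_sq, div_pow]
    field_simp
  have hT2 : ρ * (-q₂ / (2 * ρ) + a * q₁ / ρ ^ 2 - a ^ 2 * q / ρ ^ 3) / w = -(D / w) := by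
    rw [hI2]
    field_simp
  rw [hT1, hT2, sub_neg_eq_add]
  -- lower bounds for the two Hessian coefficients
  have hcoef1 : c₁ / (2 * E₁ ^ 2) ≤ ρ / w ^ 2 := by
    rw [div_le_div_iff₀ (by positivity) (by positivity)]
    have hw2 : w ^ 2 ≤ E₁ ^ 2 := pow_le_pow_left₀ hw0.le hwE₁.le 2
    have h1 : c₁ * w ^ 2 ≤ c₁ * E₁ ^ 2 := mul_le_mul_of_nonneg_left hw2 hc₁.le
    have h2 : c₁ * E₁ ^ 2 ≤ (2 * ρ) * E₁ ^ 2 :=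
      mul_le_mul_of_nonneg_right (by linarith only [hρ]) (by positivity)
    linarith only [h1, h2]
  have hcoef2 : 1 / E₁ ≤ 1 / w := one_div_le_one_div_of_le hw0 hwE₁.le
  have hX2 : 0 ≤ X ^ 2 := sq_nonneg X
  have ha2 : 0 ≤ a ^ 2 := sq_nonneg a
  have hH1 : c₁ / (2 * E₁ ^ 2) * X ^ 2 ≤ ρ / w ^ 2 * X ^ 2 :=
    mul_le_mul_of_nonneg_right hcoef1 hX2
  have hH2 : 1 / E₁ * D ≤ D / w := by
    rw [div_eq_mul_one_div D w, mul_comm D]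
    exact mul_le_mul_of_nonneg_right hcoef2 hD0
  -- abbreviate the constants
  obtain ⟨K, hK⟩ : ∃ K, K = 4 * E₁ / c₁ := ⟨_, rfl⟩
  obtain ⟨K', hK'⟩ : ∃ K', K' = 4 * E₁ ^ 2 / c₁ ^ 2 := ⟨_, rfl⟩
  rw [← hK] at hu_bd
  rw [← hK'] at he_bd
  -- comparison of `2a² + q₂ + 2c²` with `a², D, X²`
  have hP2 : P ^ 2 ≤ K * D := hCS.trans (mul_le_mul_of_nonneg_right hu_bd hD0)
  have hs_bd : s ^ 2 ≤ 2 * X ^ 2 + 2 * (K * D) := by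
    have hs : s = X + P := by rw [hX_def]; ring
    have h1 := add_sq_le_two_mul_sq X P
    rw [hs]
    linarith only [h1, hP2]
  have hc_bd : c ^ 2 ≤ 2 * s ^ 2 + 2 * (a ^ 2 * K') := by
    have hc : c = s + a * (E / ρ) := by
      rw [hs_def]
      field_simp
      ring
    have h1 := add_sq_le_two_mul_sq s (a * (E / ρ))
    have h3 : a ^ 2 * (E / ρ) ^ 2 ≤ a ^ 2 * K' := mul_le_mul_of_nonneg_left he_bd ha2
    rw [hc]
    rw [mul_pow] at h1
    linarith only [h1, h3]
  have hB' : q₂ ≤ 4 * D + 4 * (a ^ 2 * K) := by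
    have h1 : a ^ 2 * (q / ρ ^ 2) ≤ a ^ 2 * K := mul_le_mul_of_nonneg_left hu_bd ha2
    linarith only [hB, h1]
  have hm₂' : m * (4 * E₁ * (2 + 4 * K)) ≤ 3 := by
    rw [hK]
    calc m * (4 * E₁ * (2 + 4 * (4 * E₁ / c₁))) = m * (4 * E₁ * (2 + 16 * E₁ / c₁)) := by ring
      _ ≤ 3 := hm₂
  have hm₃' : m * (1 + 2 * K + 2 * K') ≤ μ := by
    rw [hK, hK']
    calc m * (1 + 2 * (4 * E₁ / c₁) + 2 * (4 * E₁ ^ 2 / c₁ ^ 2))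
        = m * (1 + 8 * E₁ / c₁ + 8 * E₁ ^ 2 / c₁ ^ 2) := by ring
      _ ≤ μ := hm₃
  have hsum : 2 * a ^ 2 + q₂ + 2 * c ^ 2
      ≤ 2 * a ^ 2 * (1 + 2 * K + 2 * K') + 2 * D * (2 + 4 * K) + 8 * X ^ 2 := by
    linarith only [hB', hc_bd, hs_bd]
  have hmsum := mul_le_mul_of_nonneg_left hsum hm
  -- the three budget inequalities
  have hB1 : m * (8 * X ^ 2) ≤ 3 / 2 * (c₁ / (2 * E₁ ^ 2) * X ^ 2) := by
    have h : m * 8 ≤ 3 / 2 * (c₁ / (2 * E₁ ^ 2)) := by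
      rw [show 3 / 2 * (c₁ / (2 * E₁ ^ 2)) = 3 * c₁ / (4 * E₁ ^ 2) by ring,
        le_div_iff₀ (by positivity)]
      linarith only [hm₁]
    have := mul_le_mul_of_nonneg_right h hX2
    linarith only [this]
  have hB2 : m * (2 * D * (2 + 4 * K)) ≤ 3 / 2 * (1 / E₁ * D) := by
    have h : m * (2 * (2 + 4 * K)) ≤ 3 / 2 * (1 / E₁) := by
      rw [show 3 / 2 * (1 / E₁) = 3 / (2 * E₁) by ring, le_div_iff₀ (by positivity)]
      linarith only [hm₂']
    have := mul_le_mul_of_nonneg_right h hD0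
    linarith only [this]
  have hB3 : m * (2 * a ^ 2 * (1 + 2 * K + 2 * K')) ≤ 2 * μ * a ^ 2 := by
    have := mul_le_mul_of_nonneg_right hm₃' (by positivity : (0 : ℝ) ≤ 2 * a ^ 2)
    linarith only [this]
  linarith only [hH1, hH2, hmsum, hB1, hB2, hB3]

variable {V : Type*} [NormedAddCommGroup V] [InnerProductSpace ℝ V]

/-- `‖x + y‖² ≤ 2‖x‖² + 2‖y‖²` (parallelogram law). [folklore] -/
theorem norm_add_sq_le_two_mul (x y : V) : ‖x + y‖ ^ 2 ≤ 2 * ‖x‖ ^ 2 + 2 * ‖y‖ ^ 2 := by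
  have h := parallelogram_law_with_norm ℝ x y
  have h0 : 0 ≤ ‖x - y‖ * ‖x - y‖ := by positivity
  nlinarith

/-- **The Hessian budget.** At a point `(ρ, mv, E)` of the kinetic chamber
`{c₁/2 < ρ, ‖mv‖² < 2ρE, E < E₁}` of a real inner product space and for a direction `(a, b, c)`,
the second derivative along the line of the ideal-gas part
`(3/2)(ρ log ρ - ρ log w) + μρ² - m(ρ² + ‖m‖² + E²)` is nonnegative under the three smallness
conditions on `m` (module docstring). [folklore] -/
theorem idealEntropy_hessian_budget {c₁ E₁ μ m : ℝ} (hc₁ : 0 < c₁) (hE₁ : 0 < E₁)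
    (hm : 0 ≤ m) (hm₁ : m * (32 * E₁ ^ 2) ≤ 3 * c₁)
    (hm₂ : m * (4 * E₁ * (2 + 16 * E₁ / c₁)) ≤ 3)
    (hm₃ : m * (1 + 8 * E₁ / c₁ + 8 * E₁ ^ 2 / c₁ ^ 2) ≤ μ)
    {ρ E a c : ℝ} {mv b : V} (hρ : c₁ / 2 < ρ) (hq : ‖mv‖ ^ 2 < 2 * ρ * E) (hE : E < E₁) :
    0 ≤ 3 / 2 * (ρ * (a / ρ - (c - 2 * ⟪mv, b⟫ / (2 * ρ) + a * ‖mv‖ ^ 2 / (2 * ρ ^ 2)) /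
          (E - ‖mv‖ ^ 2 / (2 * ρ))) ^ 2
        - ρ * (-(2 * ‖b‖ ^ 2) / (2 * ρ) + a * (2 * ⟪mv, b⟫) / ρ ^ 2 - a ^ 2 * ‖mv‖ ^ 2 / ρ ^ 3) /
          (E - ‖mv‖ ^ 2 / (2 * ρ)))
      + 2 * μ * a ^ 2 - m * (2 * a ^ 2 + 2 * ‖b‖ ^ 2 + 2 * c ^ 2) := by
  have hρ0 : 0 < ρ := by linarith
  have hρne : ρ ≠ 0 := hρ0.ne'
  -- the direction decomposition `d = b - (a/ρ) mv`, `u = mv/ρ`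
  obtain ⟨d, hd_def⟩ : ∃ d : V, d = b - (a / ρ) • mv := ⟨_, rfl⟩
  obtain ⟨u, hu_def⟩ : ∃ u : V, u = (1 / ρ) • mv := ⟨_, rfl⟩
  have hu2 : ‖u‖ ^ 2 = ‖mv‖ ^ 2 / ρ ^ 2 := by
    rw [hu_def, norm_smul, mul_pow, Real.norm_eq_abs, sq_abs]
    field_simp
  have hD : ‖d‖ ^ 2 = 2 * ‖b‖ ^ 2 / 2 - a * (2 * ⟪mv, b⟫) / ρ + a ^ 2 * ‖mv‖ ^ 2 / ρ ^ 2 := by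
    rw [hd_def, norm_sub_sq_real, real_inner_smul_right, norm_smul, mul_pow, Real.norm_eq_abs,
      sq_abs, real_inner_comm mv b]
    field_simp
  have hP : ⟪u, d⟫ = 2 * ⟪mv, b⟫ / (2 * ρ) - a * ‖mv‖ ^ 2 / ρ ^ 2 := by
    rw [hu_def, hd_def, real_inner_smul_left, inner_sub_right, real_inner_smul_right,
      real_inner_self_eq_norm_sq]
    field_simp
  have hB : 2 * ‖b‖ ^ 2 / 2 ≤ 2 * ‖d‖ ^ 2 + 2 * (a ^ 2 * (‖mv‖ ^ 2 / ρ ^ 2)) := by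
    have hb_eq : b = d + a • u := by
      rw [hd_def, hu_def, smul_smul, mul_one_div, sub_add_cancel]
    have h1 := norm_add_sq_le_two_mul d (a • u)
    rw [← hb_eq, norm_smul, mul_pow, Real.norm_eq_abs, sq_abs, hu2] at h1
    linarith
  have hCS : ⟪u, d⟫ ^ 2 ≤ ‖mv‖ ^ 2 / ρ ^ 2 * ‖d‖ ^ 2 := by
    have h1 : |⟪u, d⟫| ≤ ‖u‖ * ‖d‖ := abs_real_inner_le_norm u d
    have h2 : ⟪u, d⟫ ^ 2 ≤ (‖u‖ * ‖d‖) ^ 2 := by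
      rw [← sq_abs]
      exact pow_le_pow_left₀ (abs_nonneg _) h1 2
    rw [mul_pow, hu2] at h2
    exact h2
  exact idealEntropy_hessian_budget_real hc₁ hE₁ hm hm₁ hm₂ hm₃ hρ (sq_nonneg _) hq hE hD
    (sq_nonneg _) hP hB hCS

end Summit.AtomisticToContinuum.HydrodynamicLimit.Theorems
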